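import Summits.AtomisticToContinuum.Crystallization.Theses.SpectralChargeLedger
import Summits.AtomisticToContinuum.Crystallization.Theses.PhononSlackCertificates
import Summits.AtomisticToContinuum.Crystallization.Theorems.SpectralChargeLedgerSummedShellPricingEquivalences
import Summits.AtomisticToContinuum.Crystallization.Theorems.ChargedEnergyGap.Negative.BlocksBound

/-!
# Crux `SummedShellPricing` (stmt-AtomisticToContinuum-17044, K1 of route `SpectralChargeLedger`):
# the strategist's typed split `CoerciveTwoShellGap → HcpRelativeLedger → SummedShellPricing`

K1 prices every `τ`-bad FIRST shell at a single cell `(a₀,h₀)` against the periodic infimum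
`e⋆ = ⨅_Q e(Q)`.  The registered line `Sketch` reduced K1 to the hub crux `CoerciveTwoShellGap`
(stmt-AtomisticToContinuum-13956: `1/20`-two-shell-bad sites cost `g > 0` above `e⋆`) plus a torus
exact-cell coercivity WITH allowance (`stub_torusCoercivity`), still stated against `e⋆`.

This file lands the implication behind the split of K1 into two sub-cruxes:

* `Sub₁ = CoerciveTwoShellGap` (the hub crux, verbatim; carries ALL the non-perturbative content:
  the floor `E ≥ N e⋆` sharpened to a linear price on coarsely non-close-packed sites);
* `Sub₂ = HcpRelativeLedger` — torus exact-cell coercivity with a per-gross-site allowance,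
  ANCHORED AT `e(hcp(a₀,h₀))` instead of `e⋆` (the statement `HcpRelativeLedger` of the registered line
  `Cruxes/SummedShellPricing/Lines/hcp_relative_ledger.lean`, strategist seat s1, written inline here):
  for periodic `1/3`-separated `P`,
  `c(τ)·#{mild} − C·#{gross} ≤ #motif·(e(P) − e(hcp(a₀,h₀)))`, where `gross` = not
  `1/20`-two-shell-good and `mild` = `τ`-bad first shell at the cell but two-shell-good.  No `e⋆`
  occurs in `Sub₂`: it is a statement about the Lennard-Jones landscape within `1/20` of close
  packing, relative to the COMPUTABLE number `e(hcp(a₀,h₀))`, so it is both provable (perturbative: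
  uniform polytype stability, Hägg domination `LjRegistryDomination`, cell convexity, localisation
  with the gross allowance paying for chart boundaries) and refutable (certified comparison with
  `e(hcp(a₀,h₀))`) without any knowledge of `e⋆`.

`Sub₂ ⇒ core` is one line (`e⋆ ≤ e(hcp(a₀,h₀))`, `ciInf_le` with
`ChargedEnergyGapNegative.bddBelow_energyPerParticle_lennardJones`), and `Sub₁ ∧ core ⇒ K1` is the
landed composition `SummedShellPricingEquivalences.summedShellPricing_of_coerciveTwoShellGap_of_torusCoercivity`
(p167766 ← p101526, p166291, p166315, p166632).  All `[folklore]`; no new definitions (the sub-crux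
statements are written inline; the route's split installs them as items).
-/

noncomputable section

namespace Summit.AtomisticToContinuum.Crystallization.Theorems.SummedShellPricingSplit

open scoped BigOperators Classical
open Literature.MathematicalPhysics.StatisticalMechanics Literature.Geometry.DiscreteGeometry

/-- **`Sub₂ ⇒ core`.**  Torus exact-cell coercivity anchored at `e(hcp(a₀,h₀))` implies the same
inequality anchored at the periodic infimum `e⋆` (the core `stub_torusCoercivity` of line `Sketch`),
because `e⋆ ≤ e(hcp(a₀,h₀))` (`ciInf_le`). [folklore] -/
theorem torusCoercivity_of_hcpRelativeLedger
    (h2 : ∃ a₀ h₀ : ℝ, ∃ ha : a₀ ≠ 0, ∃ hh : h₀ ≠ 0, 47 / 50 ≤ a₀ ∧ a₀ ≤ 1 ∧ |h₀ - a₀ * Real.sqrt (2 / 3)| ≤ a₀ / 100 ∧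
       ∃ C : ℝ, 0 ≤ C ∧ ∀ τ : ℝ, 0 < τ → τ ≤ 1 → ∃ c : ℝ, 0 < c ∧
         ∀ P : PeriodicConfiguration 3, (∀ u ∈ P.points, ∀ v ∈ P.points, u ≠ v → (1 / 3 : ℝ) ≤ dist u v) →
           c * ((P.motif.filter fun q =>
               ¬ (∃ A : EuclideanSpace ℝ (Fin 3) →ₗᵢ[ℝ] EuclideanSpace ℝ (Fin 3),
                   (∃ e : ↥{z : EuclideanSpace ℝ (Fin 3) | z ∈ P.points ∧ z ≠ q ∧ dist z (q) < 13 / 10 * a₀} ≃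
                       ↥{p : EuclideanSpace ℝ (Fin 3) | p ∈ hcpStacking a₀ h₀ ∧ p ≠ 0 ∧ ‖p‖ < 13 / 10 * a₀},
                     ∀ t : ↥{z : EuclideanSpace ℝ (Fin 3) | z ∈ P.points ∧ z ≠ q ∧ dist z (q) < 13 / 10 * a₀},
                       dist ((t : EuclideanSpace ℝ (Fin 3)) - q)
                         (A ((e t : ↥{p : EuclideanSpace ℝ (Fin 3) | p ∈ hcpStacking a₀ h₀ ∧ p ≠ 0 ∧ ‖p‖ < 13 / 10 * a₀}) : EuclideanSpace ℝ (Fin 3))) ≤ τ) ∨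
                   (∃ e : ↥{z : EuclideanSpace ℝ (Fin 3) | z ∈ P.points ∧ z ≠ q ∧ dist z (q) < 13 / 10 * a₀} ≃
                       ↥{p : EuclideanSpace ℝ (Fin 3) | p ∈ fccStacking a₀ h₀ ∧ p ≠ 0 ∧ ‖p‖ < 13 / 10 * a₀},
                     ∀ t : ↥{z : EuclideanSpace ℝ (Fin 3) | z ∈ P.points ∧ z ≠ q ∧ dist z (q) < 13 / 10 * a₀},
                       dist ((t : EuclideanSpace ℝ (Fin 3)) - q)
                         (A ((e t : ↥{p : EuclideanSpace ℝ (Fin 3) | p ∈ fccStacking a₀ h₀ ∧ p ≠ 0 ∧ ‖p‖ < 13 / 10 * a₀}) : EuclideanSpace ℝ (Fin 3))) ≤ τ)) ∧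
               IsTwoShellGoodSet (1 / 20) (47 / 50) 1 P.points q).card : ℝ)
             - C * ((P.motif.filter fun q => ¬ IsTwoShellGoodSet (1 / 20) (47 / 50) 1 P.points q).card : ℝ)
           ≤ (P.motif.card : ℝ) * (P.energyPerParticle lennardJones - (hcpPeriodicConfiguration ha hh).energyPerParticle lennardJones)) :
    ∃ a₀ h₀ : ℝ, 47 / 50 ≤ a₀ ∧ a₀ ≤ 1 ∧ |h₀ - a₀ * Real.sqrt (2 / 3)| ≤ a₀ / 100 ∧
      ∃ C : ℝ, 0 ≤ C ∧ ∀ τ : ℝ, 0 < τ → τ ≤ 1 → ∃ c : ℝ, 0 < c ∧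
        ∀ P : PeriodicConfiguration 3, (∀ u ∈ P.points, ∀ v ∈ P.points, u ≠ v → (1 / 3 : ℝ) ≤ dist u v) →
          c * ((P.motif.filter fun q =>
              ¬ (∃ A : EuclideanSpace ℝ (Fin 3) →ₗᵢ[ℝ] EuclideanSpace ℝ (Fin 3),
                  (∃ e : ↥{z : EuclideanSpace ℝ (Fin 3) | z ∈ P.points ∧ z ≠ q ∧ dist z (q) < 13 / 10 * a₀} ≃
                      ↥{p : EuclideanSpace ℝ (Fin 3) | p ∈ hcpStacking a₀ h₀ ∧ p ≠ 0 ∧ ‖p‖ < 13 / 10 * a₀},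
                    ∀ t : ↥{z : EuclideanSpace ℝ (Fin 3) | z ∈ P.points ∧ z ≠ q ∧ dist z (q) < 13 / 10 * a₀},
                      dist ((t : EuclideanSpace ℝ (Fin 3)) - q)
                        (A ((e t : ↥{p : EuclideanSpace ℝ (Fin 3) | p ∈ hcpStacking a₀ h₀ ∧ p ≠ 0 ∧ ‖p‖ < 13 / 10 * a₀}) : EuclideanSpace ℝ (Fin 3))) ≤ τ) ∨
                  (∃ e : ↥{z : EuclideanSpace ℝ (Fin 3) | z ∈ P.points ∧ z ≠ q ∧ dist z (q) < 13 / 10 * a₀} ≃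
                      ↥{p : EuclideanSpace ℝ (Fin 3) | p ∈ fccStacking a₀ h₀ ∧ p ≠ 0 ∧ ‖p‖ < 13 / 10 * a₀},
                    ∀ t : ↥{z : EuclideanSpace ℝ (Fin 3) | z ∈ P.points ∧ z ≠ q ∧ dist z (q) < 13 / 10 * a₀},
                      dist ((t : EuclideanSpace ℝ (Fin 3)) - q)
                        (A ((e t : ↥{p : EuclideanSpace ℝ (Fin 3) | p ∈ fccStacking a₀ h₀ ∧ p ≠ 0 ∧ ‖p‖ < 13 / 10 * a₀}) : EuclideanSpace ℝ (Fin 3))) ≤ τ)) ∧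
              IsTwoShellGoodSet (1 / 20) (47 / 50) 1 P.points q).card : ℝ)
            - C * ((P.motif.filter fun q => ¬ IsTwoShellGoodSet (1 / 20) (47 / 50) 1 P.points q).card : ℝ)
          ≤ (P.motif.card : ℝ) * (P.energyPerParticle lennardJones - (⨅ Q : PeriodicConfiguration 3, Q.energyPerParticle lennardJones)) := by
  obtain ⟨a₀, h₀, ha, hh, hb1, hb2, hb3, C, hC, hT⟩ := h2
  refine ⟨a₀, h₀, hb1, hb2, hb3, C, hC, fun τ hτ hτ1 => ?_⟩
  obtain ⟨c, hc, hP⟩ := hT τ hτ hτ1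
  refine ⟨c, hc, fun P hsep => (hP P hsep).trans ?_⟩
  have he : (⨅ Q : PeriodicConfiguration 3, Q.energyPerParticle lennardJones) ≤
      (hcpPeriodicConfiguration ha hh).energyPerParticle lennardJones :=
    ciInf_le ChargedEnergyGapNegative.bddBelow_energyPerParticle_lennardJones _
  exact mul_le_mul_of_nonneg_left (by linarith) (Nat.cast_nonneg _)

/-- **The split `Sub₁ → Sub₂ → K1`.**  The hub crux `CoerciveTwoShellGap`
(stmt-AtomisticToContinuum-13956) and torus exact-cell coercivity anchored at `e(hcp(a₀,h₀))`
together imply `SummedShellPricing`: `Sub₂ ⇒ core` (`torusCoercivity_of_hcpRelativeLedger`) and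
`Sub₁ ∧ core ⇒ K1` (`summedShellPricing_of_coerciveTwoShellGap_of_torusCoercivity`, p167766).
[folklore] -/
theorem SummedShellPricing_of_subs
    (h1 : Summit.AtomisticToContinuum.Crystallization.Theses.PhononSlackCertificates.CoerciveTwoShellGap)
    (h2 : ∃ a₀ h₀ : ℝ, ∃ ha : a₀ ≠ 0, ∃ hh : h₀ ≠ 0, 47 / 50 ≤ a₀ ∧ a₀ ≤ 1 ∧ |h₀ - a₀ * Real.sqrt (2 / 3)| ≤ a₀ / 100 ∧
       ∃ C : ℝ, 0 ≤ C ∧ ∀ τ : ℝ, 0 < τ → τ ≤ 1 → ∃ c : ℝ, 0 < c ∧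
         ∀ P : PeriodicConfiguration 3, (∀ u ∈ P.points, ∀ v ∈ P.points, u ≠ v → (1 / 3 : ℝ) ≤ dist u v) →
           c * ((P.motif.filter fun q =>
               ¬ (∃ A : EuclideanSpace ℝ (Fin 3) →ₗᵢ[ℝ] EuclideanSpace ℝ (Fin 3),
                   (∃ e : ↥{z : EuclideanSpace ℝ (Fin 3) | z ∈ P.points ∧ z ≠ q ∧ dist z (q) < 13 / 10 * a₀} ≃
                       ↥{p : EuclideanSpace ℝ (Fin 3) | p ∈ hcpStacking a₀ h₀ ∧ p ≠ 0 ∧ ‖p‖ < 13 / 10 * a₀},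
                     ∀ t : ↥{z : EuclideanSpace ℝ (Fin 3) | z ∈ P.points ∧ z ≠ q ∧ dist z (q) < 13 / 10 * a₀},
                       dist ((t : EuclideanSpace ℝ (Fin 3)) - q)
                         (A ((e t : ↥{p : EuclideanSpace ℝ (Fin 3) | p ∈ hcpStacking a₀ h₀ ∧ p ≠ 0 ∧ ‖p‖ < 13 / 10 * a₀}) : EuclideanSpace ℝ (Fin 3))) ≤ τ) ∨
                   (∃ e : ↥{z : EuclideanSpace ℝ (Fin 3) | z ∈ P.points ∧ z ≠ q ∧ dist z (q) < 13 / 10 * a₀} ≃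
                       ↥{p : EuclideanSpace ℝ (Fin 3) | p ∈ fccStacking a₀ h₀ ∧ p ≠ 0 ∧ ‖p‖ < 13 / 10 * a₀},
                     ∀ t : ↥{z : EuclideanSpace ℝ (Fin 3) | z ∈ P.points ∧ z ≠ q ∧ dist z (q) < 13 / 10 * a₀},
                       dist ((t : EuclideanSpace ℝ (Fin 3)) - q)
                         (A ((e t : ↥{p : EuclideanSpace ℝ (Fin 3) | p ∈ fccStacking a₀ h₀ ∧ p ≠ 0 ∧ ‖p‖ < 13 / 10 * a₀}) : EuclideanSpace ℝ (Fin 3))) ≤ τ)) ∧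
               IsTwoShellGoodSet (1 / 20) (47 / 50) 1 P.points q).card : ℝ)
             - C * ((P.motif.filter fun q => ¬ IsTwoShellGoodSet (1 / 20) (47 / 50) 1 P.points q).card : ℝ)
           ≤ (P.motif.card : ℝ) * (P.energyPerParticle lennardJones - (hcpPeriodicConfiguration ha hh).energyPerParticle lennardJones)) :
    Summit.AtomisticToContinuum.Crystallization.Theses.SpectralChargeLedger.SummedShellPricing :=
  SummedShellPricingEquivalences.summedShellPricing_of_coerciveTwoShellGap_of_torusCoercivity h1
    (torusCoercivity_of_hcpRelativeLedger h2)

end Summit.AtomisticToContinuum.Crystallization.Theorems.SummedShellPricingSplit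

end
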